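import Literature.NumberTheory.LFunctions.WeilTwoPrimeOddMarginFBase
import Literature.NumberTheory.LFunctions.WeilTwoPrimeOddMarginFDataDn2
import Literature.NumberTheory.LFunctions.WeilBlockRowsPZ
import HarnessLib

/-!
# Two-prime odd-margin certificate F: the Bessel block claim `Hp = C H Cᵀ`, rows 30–34

`WeilCert.checkHpRow` for rows 30–34 of certificate F (the exact Legendre cancellation `C H Cᵀ = diag(2a₀/(4i+3))`), by `decide +kernel`. Pure proof file.
-/

noncomputable section

namespace Literature.NumberTheory.LFunctions

set_option maxHeartbeats 0 in
/-- Row 30 of `C H Cᵀ` is row 30 of `Hp` (certificate F). [folklore] -/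
theorem checkHpRow1_30_weilCert23F : weilCert23FBase.checkHpRow weilCert23FHp 1 30 = true := by
  decide +kernel

set_option maxHeartbeats 0 in
/-- Row 31 of `C H Cᵀ` is row 31 of `Hp` (certificate F). [folklore] -/
theorem checkHpRow1_31_weilCert23F : weilCert23FBase.checkHpRow weilCert23FHp 1 31 = true := by
  decide +kernel

set_option maxHeartbeats 0 in
/-- Row 32 of `C H Cᵀ` is row 32 of `Hp` (certificate F). [folklore] -/
theorem checkHpRow1_32_weilCert23F : weilCert23FBase.checkHpRow weilCert23FHp 1 32 = true := by
  decide +kernel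

set_option maxHeartbeats 0 in
/-- Row 33 of `C H Cᵀ` is row 33 of `Hp` (certificate F). [folklore] -/
theorem checkHpRow1_33_weilCert23F : weilCert23FBase.checkHpRow weilCert23FHp 1 33 = true := by
  decide +kernel

set_option maxHeartbeats 0 in
/-- Row 34 of `C H Cᵀ` is row 34 of `Hp` (certificate F). [folklore] -/
theorem checkHpRow1_34_weilCert23F : weilCert23FBase.checkHpRow weilCert23FHp 1 34 = true := by
  decide +kernel


end Literature.NumberTheory.LFunctions
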